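import Summits.AtomisticToContinuum.Crystallization.Theorems.OverbindingBudgetAffineCompressedCutRunBox
import Summits.AtomisticToContinuum.Crystallization.Theorems.OverbindingBudgetAffineCompressedCutBudget

/-!
# Overbinding budget — compressed cut: R4 «LR(r₁)» VI — BOX BOUNDS (base reach, column norms, ROOM discharge, the record run)

Record: route `OverbindingBudget`, crux `RobustDefectLimitWindows` (stmt-AtomisticToContinuum-31280); open leaf NS♭₂ ⟸ 79K ⟸ LR(r₁); R4 «LR(r₁)».
Continuation of `…CompressedCutRunBox` + `…CompressedCutBudget`: the designation lemmas that turn the hypotheses of `stack_run_box` into the priced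
inequalities of «Budget», and the record run with every analytic hypothesis discharged.

* §1 ★ `layer_disc_off_hcp'` — `…OffDisc.layer_disc_off_hcp` with the HEX-DISTANCE reach `6n + lnorm x₀ ≤ 6·dm` in place of `2n ≤ dm` (record:
  `n = 9`, seed offset `lnorm x₀ ≤ 24` ⇒ `dm = 13`, not `18`), conclusion on the base box `InBox 0 (3n)` (the input shape of `stack_run_box`).
* §2 COLUMN NORMS: `tsq_le_of_inBox` (sum-zero `t` in the box `K` ⇒ `tsq t ≤ 2K²`), `tsq_tadd_axis` (`tsq((k,k,k) + u) = 3k² + tsq u`),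
  ★ `norm_mv_axis_box_le` (`‖mv((k,k,k) + u)‖ ≤ √(k²/6 + K²/9)`), `inBox_widen`, `column_axis`.
* §3 ROOM DISCHARGE against «Budget» `room_budget` (`γ = (401/400)ν`, `r = 12ν`): ★ `room_run_A` (column through `(k₀,k₀,k₀) + w`, `|w_c| ≤ 2`,
  levels `|k₀ + 2sg(m+1)| ≤ 12`, `K₀ ≤ 27`, `a + L ≤ 31` ⇒ the `hroom` of `stack_run_box`), ★ `room_base_A` (the `hroom` of `layer_disc_off_hcp'`,
  `n = 9`, `a + dm ≤ 19`), `room_run_B` / `room_base_B` (Case B: `K₀ ≤ 18`, `|2sg(m+1)| ≤ 10`, `n = 6`).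
* §4 ★ `stack_run_box_record` — `stack_run_box` with the record sequences `τs m = tauR ν (a+m)`, `Ds m = dR ν (a+m)`, `νs m = λ^m ν₀`,
  `ν's m = Λ^m ν′₀`, `β = (399/400)ν`, `γ = (401/400)ν`, `r = 12ν`: ALL of `hτ hD hν hν' hΔ hsmall hΔk hid hmono hroom` discharged by «Budget»
  (`run_structural`, `run_resolution`) and §3; what remains is geometric (`hB hBup`, the base patch, `(L:ℤ)+1 ≤ K₀ ≤ 27`, the level range, `a + L ≤ 31`).

Deps: `…CompressedCutRunBox`, `…CompressedCutBudget`.  No `instance`, no `notation`, no `set_option`, no new axioms, 0 sorry.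
-/


namespace Summit.AtomisticToContinuum.Crystallization.Theorems.OverbindingBudgetAffineCompressedCutBoxBounds

open Literature.Geometry.DiscreteGeometry (nearestDist nearestDist_nonneg fccTwoShellPattern hcpTwoShellPattern)
open Summit.AtomisticToContinuum.Crystallization.Theorems.OverbindingBudgetAffineCompressedCutKernel (T3 tsub tadd tsq thsum fccL fccNegL hcpL hcpAltL
  hexL capL)
open Summit.AtomisticToContinuum.Crystallization.Theorems.OverbindingBudgetAffineCompressedCutCharts (mv norm_mv_sq)
open Summit.AtomisticToContinuum.Crystallization.Theorems.OverbindingBudgetAffineCompressedCutEstablish (Estab)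
open Summit.AtomisticToContinuum.Crystallization.Theorems.OverbindingBudgetAffineCompressedCutSeed (InLayer lnorm tadd_zero_left)
open Summit.AtomisticToContinuum.Crystallization.Theorems.OverbindingBudgetAffineCompressedCutOffDisc (lnorm_tsub_le layer_disc_off e1_tables)
open Summit.AtomisticToContinuum.Crystallization.Theorems.OverbindingBudgetAffineCompressedCutRun (thsum_tadd)
open Summit.AtomisticToContinuum.Crystallization.Theorems.OverbindingBudgetAffineCompressedCutPatch (InBox capv dL lnorm_le_of_inBox inBox_of_lnorm_le)
open Summit.AtomisticToContinuum.Crystallization.Theorems.OverbindingBudgetAffineCompressedCutRunBox (column stack_run_box)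
open Summit.AtomisticToContinuum.Crystallization.Theorems.OverbindingBudgetAffineCompressedCutBudget (tauR dR tauR_dR_mono window_hi run_structural
  run_resolution room_budget)

variable {N : ℕ}

/-! ## §1  The base box from an hcp seed, hex-distance reach -/

/-- ★ **Record base patch (Case A).**  A seed `j₀` charted onto `H` or `H′` at label `q₀ + x₀` (a layer vector of the hex ball of radius `n` about the
centre label `q₀`), any base frame `B`; the two step inequalities below `dm`; room `‖B(q₀ + x)‖ + Ds dm ≤ r` on the ball; and the HEX-DISTANCE REACH
`6n + lnorm x₀ ≤ 6·dm` (every point of the ball is within hex distance `dm` of the seed).  Conclusion: every layer vector of the base box `InBox 0 (3n)`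
labels an established site charted onto the SAME copy, bounds `(τs dm, Ds dm)`, scale in `[0.9967^dm, 1.0011^dm]·nn_{j₀}`. [this file] -/
theorem layer_disc_off_hcp' {y : Fin N → EuclideanSpace ℝ (Fin 3)} (hy : Function.Injective y) {r : ℝ} {i : Fin N}
    {A : Fin N → (EuclideanSpace ℝ (Fin 3) →ₗ[ℝ] EuclideanSpace ℝ (Fin 3))} {Qf : Fin N → (EuclideanSpace ℝ (Fin 3) →ₗᵢ[ℝ] EuclideanSpace ℝ (Fin 3))}
    {P : Fin N → Finset (EuclideanSpace ℝ (Fin 3))} {f : Fin N → EuclideanSpace ℝ (Fin 3) → EuclideanSpace ℝ (Fin 3)}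
    {B : EuclideanSpace ℝ (Fin 3) →ₗ[ℝ] EuclideanSpace ℝ (Fin 3)}
    (hP : ∀ j, dist (y j) (y i) ≤ r → (P j = fccTwoShellPattern ∨ P j = hcpTwoShellPattern))
    (hA : ∀ j, dist (y j) (y i) ≤ r → ∀ v ∈ P j, ‖A j v - Qf j v‖ ≤ 1 / 1000)
    (hf : ∀ j, dist (y j) (y i) ≤ r → ∀ v ∈ P j, f j v ∈ Set.range y ∧ dist (f j v) (y j + nearestDist y j • A j v) ≤ 1 / 10 ^ 4 * nearestDist y j)
    (hinj : ∀ j, dist (y j) (y i) ≤ r → Set.InjOn (f j) ↑(P j))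
    (hex : ∀ j, dist (y j) (y i) ≤ r → ∀ m, m ≠ j → dist (y m) (y j) ≤ (3 / 2 + 1 / 450) * nearestDist y j → ∃ v ∈ P j, f j v = y m)
    {C : List T3} (hC : C = hcpL ∨ C = hcpAltL)
    {j₀ : Fin N} {M₀ : EuclideanSpace ℝ (Fin 3) →ₗᵢ[ℝ] EuclideanSpace ℝ (Fin 3)} {q₀ x₀ : T3} {τs Ds : ℕ → ℝ} {n dm : ℕ}
    (hreach : 6 * (n : ℤ) + lnorm x₀ ≤ 6 * (dm : ℤ)) (hx₀ : InLayer x₀) (hx₀b : lnorm x₀ ≤ 6 * (n : ℤ))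
    (hj₀ : dist (y j₀) (y i) ≤ r) (hE₀ : Estab y A P B i j₀ M₀ C (tadd q₀ x₀) (τs 0) (Ds 0)) (hτmono : Monotone τs) (hDmono : Monotone Ds)
    (hτs : ∀ d : ℕ, d + 1 ≤ dm → τs d + 5 / 2 * (2 * (1 / 10 ^ 4) * ((10011 / 10000 : ℝ) ^ d * nearestDist y j₀) +
      1 / 10 ^ 4 * ((10011 / 10000 : ℝ) ^ (d + 1) * nearestDist y j₀)) ≤ τs (d + 1))
    (hDs : ∀ d : ℕ, d + 1 ≤ dm → Ds d + 1 / 10 ^ 4 * ((10011 / 10000 : ℝ) ^ d * nearestDist y j₀) + τs d ≤ Ds (d + 1))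
    (hroom : ∀ x, InLayer x → lnorm x ≤ 6 * (n : ℤ) → ‖B (mv (tadd q₀ x))‖ + Ds dm ≤ r) :
    ∀ x : T3, InLayer x → InBox (0, 0, 0) (3 * (n : ℤ)) x →
      ∃ k : Fin N, ∃ M : EuclideanSpace ℝ (Fin 3) →ₗᵢ[ℝ] EuclideanSpace ℝ (Fin 3), dist (y k) (y i) ≤ r ∧
        (9967 / 10000 : ℝ) ^ dm * nearestDist y j₀ ≤ nearestDist y k ∧ nearestDist y k ≤ (10011 / 10000 : ℝ) ^ dm * nearestDist y j₀ ∧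
        Estab y A P B i k M C (tadd q₀ x) (τs dm) (Ds dm) := by
  obtain ⟨hKf, hKh, hhexC⟩ := e1_tables hC
  have hQC : ∀ k, dist (y k) (y i) ≤ r → ∀ Q : List T3,
      ((P k = fccTwoShellPattern ∧ Q ∈ ([] : List (List T3))) ∨ (P k = hcpTwoShellPattern ∧ Q ∈ [C])) → Q = C := by
    intro k _ Q hQ
    rcases hQ with ⟨-, hQ⟩ | ⟨-, hQ⟩
    · simp at hQ
    · simpa using hQ
  have hlh : ∀ Q ∈ [C], Q.length ≤ 18 := by
    intro Q hQ
    rw [List.mem_singleton] at hQ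
    rw [hQ]
    rcases hC with rfl | rfl <;> decide
  intro x hx hb
  have hxb : lnorm x ≤ 6 * (n : ℤ) := lnorm_le_of_inBox hx hb
  have hdist : lnorm (tsub x x₀) ≤ 6 * (dm : ℤ) := by linarith [lnorm_tsub_le x x₀]
  exact layer_disc_off hy hP hA hf hinj hex hKf hKh (by simp) hlh hhexC (fun h hh => hh) hQC hx₀ hx₀b hj₀ hE₀ hτmono hDmono hτs hDs hroom dm
    le_rfl x hx hxb hdist

/-! ## §2  Column norms -/

/-- Two same-signed coordinates and the bound on the third give `tsq ≤ 2K²`. [this file] -/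
theorem sq_sum_le_of_pair {a b c K : ℤ} (h0 : a + b + c = 0) (hab : 0 ≤ a * b) (hc : -K ≤ c) (hc' : c ≤ K) :
    a * a + b * b + c * c ≤ 2 * K ^ 2 := by
  have e : c = -(a + b) := by linarith
  subst e
  nlinarith [mul_nonneg (by linarith : (0 : ℤ) ≤ K + (a + b)) (by linarith : (0 : ℤ) ≤ K - (-(a + b)) + 0)]

/-- A sum-zero vector of the box `K` has squared length `≤ 2K²` (equality at the hexagon's vertices `(K, 0, −K)`). [this file] -/
theorem tsq_le_of_inBox {t : T3} {K : ℤ} (ht : thsum t = 0) (hb : InBox (0, 0, 0) K t) : tsq t ≤ 2 * K ^ 2 := by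
  obtain ⟨t₁, t₂, t₃⟩ := t
  obtain ⟨h1, h2, h3⟩ := hb
  simp only [thsum, tsq] at ht ⊢
  simp only [add_zero, abs_le] at h1 h2 h3
  rcases le_or_gt 0 t₁ with s1 | s1 <;> rcases le_or_gt 0 t₂ with s2 | s2
  · exact sq_sum_le_of_pair ht (mul_nonneg s1 s2) h3.1 h3.2
  · rcases le_or_gt 0 t₃ with s3 | s3
    · linarith [sq_sum_le_of_pair (by linarith : t₁ + t₃ + t₂ = 0) (mul_nonneg s1 s3) h2.1 h2.2]
    · linarith [sq_sum_le_of_pair (by linarith : t₂ + t₃ + t₁ = 0) (mul_pos_of_neg_of_neg s2 s3).le h1.1 h1.2]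
  · rcases le_or_gt 0 t₃ with s3 | s3
    · linarith [sq_sum_le_of_pair (by linarith : t₂ + t₃ + t₁ = 0) (mul_nonneg s2 s3) h1.1 h1.2]
    · linarith [sq_sum_le_of_pair (by linarith : t₁ + t₃ + t₂ = 0) (mul_pos_of_neg_of_neg s1 s3).le h2.1 h2.2]
  · exact sq_sum_le_of_pair ht (mul_pos_of_neg_of_neg s1 s2).le h3.1 h3.2

/-- Pythagoras for the column: `tsq ((k,k,k) + u) = 3k² + tsq u` for sum-zero `u`. [this file] -/
theorem tsq_tadd_axis {u : T3} (k : ℤ) (hu : thsum u = 0) : tsq (tadd (k, k, k) u) = 3 * k ^ 2 + tsq u := by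
  obtain ⟨u₁, u₂, u₃⟩ := u
  simp only [thsum, tsq, tadd] at hu ⊢
  have e : u₃ = -(u₁ + u₂) := by linarith
  subst e
  ring

/-- ★ **Column norm bound.**  A label `(k,k,k) + u` with `u` sum-zero in the box `K` has model length `≤ √(k²/6 + K²/9)` (height `|k|/√6`, horizontal
`≤ K/3`). [this file] -/
theorem norm_mv_axis_box_le {u : T3} {k K : ℤ} (hu : thsum u = 0) (hb : InBox (0, 0, 0) K u) :
    ‖mv (tadd (k, k, k) u)‖ ≤ Real.sqrt ((k : ℝ) ^ 2 / 6 + (K : ℝ) ^ 2 / 9) := by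
  have h1 : ‖mv (tadd (k, k, k) u)‖ ^ 2 ≤ (k : ℝ) ^ 2 / 6 + (K : ℝ) ^ 2 / 9 := by
    rw [norm_mv_sq, tsq_tadd_axis k hu]
    have h := tsq_le_of_inBox hu hb
    have h' : ((tsq u : ℤ) : ℝ) ≤ 2 * (K : ℝ) ^ 2 := by exact_mod_cast h
    push_cast
    linarith
  exact (le_abs_self _).trans (Real.abs_le_sqrt h1)

/-- Widening a box by a bounded offset: `|w_c| ≤ k` and `t` in the box `K` put `w + t` in the box `K + k`. [this file] -/
theorem inBox_widen {w t : T3} {K k : ℤ} (hw : InBox (0, 0, 0) k w) (ht : InBox (0, 0, 0) K t) : InBox (0, 0, 0) (K + k) (tadd w t) := by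
  obtain ⟨a1, a2, a3⟩ := hw
  obtain ⟨b1, b2, b3⟩ := ht
  simp only [InBox, tadd, add_zero, abs_le] at a1 a2 a3 b1 b2 b3 ⊢
  omega

/-- The column label through `(k₀,k₀,k₀) + w` at signed level `q`, plus an offset `t`, in axis form. [this file] -/
theorem column_axis (k₀ sg q : ℤ) (w t : T3) :
    tadd (column (tadd (k₀, k₀, k₀) w) sg q) t = tadd (k₀ + 2 * sg * q, k₀ + 2 * sg * q, k₀ + 2 * sg * q) (tadd w t) := by
  obtain ⟨w₁, w₂, w₃⟩ := w
  obtain ⟨t₁, t₂, t₃⟩ := t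
  simp only [column, tadd, Prod.mk.injEq]
  refine ⟨by ring, by ring, by ring⟩

/-! ## §3  Room discharge (`γ = (401/400)ν`, `r = 12ν`) -/

/-- Monotone room envelope: `|k| ≤ kM`, box `0 ≤ K ≤ KM` ⇒ `‖mv((k,k,k) + u)‖ ≤ √(kM²/6 + KM²/9)`. [this file] -/
theorem norm_mv_axis_box_le' {u : T3} {k K kM KM : ℤ} (hu : thsum u = 0) (hb : InBox (0, 0, 0) K u) (hk : |k| ≤ kM) (hK0 : 0 ≤ K)
    (hK : K ≤ KM) : ‖mv (tadd (k, k, k) u)‖ ≤ Real.sqrt ((kM : ℝ) ^ 2 / 6 + (KM : ℝ) ^ 2 / 9) := by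
  refine (norm_mv_axis_box_le hu hb).trans (Real.sqrt_le_sqrt ?_)
  obtain ⟨hk1, hk2⟩ := abs_le.1 hk
  have h1 : k ^ 2 ≤ kM ^ 2 := by nlinarith [mul_nonneg (by linarith : (0 : ℤ) ≤ kM - k) (by linarith : (0 : ℤ) ≤ kM + k)]
  have h2 : K ^ 2 ≤ KM ^ 2 := by nlinarith
  have h1' : (k : ℝ) ^ 2 ≤ (kM : ℝ) ^ 2 := by exact_mod_cast h1
  have h2' : (K : ℝ) ^ 2 ≤ (KM : ℝ) ^ 2 := by exact_mod_cast h2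
  linarith

/-- ★ **ROOM, Case A run** (the `hroom` of `stack_run_box` with `γ = (401/400)ν`, `r = 12ν` and the record sequences): column through `(k₀,k₀,k₀) + w`
with `|w_c| ≤ 2`, levels `|k₀ + 2sg(m+1)| ≤ 12` (`= 2|ℓ|`, `|ℓ| ≤ 6`), `(L:ℤ) + 1 ≤ K₀ ≤ 27`, `ν′₀ ≤ Λ^a ν`, `a + L ≤ 31`. [this file] -/
theorem room_run_A {ν ν'₀ : ℝ} (hν : 0 < ν) {a L : ℕ} (hsw : ν'₀ ≤ (10011 / 10000 : ℝ) ^ a * ν) (haL : a + L ≤ 31)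
    {k₀ sg K₀ : ℤ} {w : T3} (hw : InBox (0, 0, 0) 2 w) (hw0 : thsum w = 0) (hK : K₀ ≤ 27) (hL : (L : ℤ) + 1 ≤ K₀)
    (hk : ∀ m, m < L → |k₀ + 2 * sg * ((m : ℤ) + 1)| ≤ 12) :
    ∀ m, m < L → ∀ t : T3, thsum t = 0 → InBox (0, 0, 0) (K₀ - ((m : ℤ) + 1)) t →
      401 / 400 * ν * ‖mv (tadd (column (tadd (k₀, k₀, k₀) w) sg ((m : ℤ) + 1)) t)‖ +
        (dR ν (a + (m + 1)) + 1 / 10 ^ 4 * ((10011 / 10000 : ℝ) ^ (m + 1) * ν'₀) + tauR ν (a + (m + 1))) ≤ 12 * ν := by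
  intro m hm t ht hb
  rw [column_axis]
  have hwt : thsum (tadd w t) = 0 := by rw [thsum_tadd, hw0, ht]; norm_num
  have hn := norm_mv_axis_box_le' hwt (inBox_widen hw hb) (hk m hm) (by omega) (by omega : K₀ - ((m : ℤ) + 1) + 2 ≤ 28)
  obtain ⟨-, hR, -⟩ := room_budget hν
  have e1 := window_hi hν.le hsw (by omega : a + (m + 1) ≤ 31)
  obtain ⟨-, e2, -, e3⟩ := tauR_dR_mono hν.le (by omega : a + (m + 1) ≤ 31)
  nlinarith [mul_le_mul_of_nonneg_left hn (by positivity : (0 : ℝ) ≤ 401 / 400 * ν)]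

/-- ★ **ROOM, Case A base** (the `hroom` of `layer_disc_off_hcp'`, `n = 9`, frame `‖B z‖ ≤ (401/400)ν‖z‖`, centre label `(k₀,k₀,k₀) + w`, `|k₀| ≤ 12`,
bound `Ds dm = dR ν (a + dm)` with `a + dm ≤ 19`). [this file] -/
theorem room_base_A {ν : ℝ} (hν : 0 < ν) {B : EuclideanSpace ℝ (Fin 3) →ₗ[ℝ] EuclideanSpace ℝ (Fin 3)} (hBup : ∀ z, ‖B z‖ ≤ 401 / 400 * ν * ‖z‖)
    {k₀ : ℤ} {w : T3} (hw : InBox (0, 0, 0) 2 w) (hw0 : thsum w = 0) (hk : |k₀| ≤ 12) {a dm : ℕ} (h19 : a + dm ≤ 19) :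
    ∀ x, InLayer x → lnorm x ≤ 6 * 9 → ‖B (mv (tadd (tadd (k₀, k₀, k₀) w) x))‖ + dR ν (a + dm) ≤ 12 * ν := by
  intro x hx hl
  rw [Summit.AtomisticToContinuum.Crystallization.Theorems.OverbindingBudgetAffineCompressedCutPatch.tadd_tadd_assoc]
  have hwt : thsum (tadd w x) = 0 := by rw [thsum_tadd, hw0, show thsum x = 0 from hx.1]; norm_num
  have hn := norm_mv_axis_box_le' hwt (inBox_widen hw (inBox_of_lnorm_le hx hl)) hk (by norm_num) (by norm_num : (3 * 9 : ℤ) + 2 ≤ 29)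
  obtain ⟨hR, -, -⟩ := room_budget hν
  obtain ⟨-, -, -, e3⟩ := tauR_dR_mono hν.le h19
  nlinarith [hBup (mv (tadd (k₀, k₀, k₀) (tadd w x))), mul_le_mul_of_nonneg_left hn (by positivity : (0 : ℝ) ≤ 401 / 400 * ν)]

/-- **ROOM, Case B run** (column through `i` itself: `lam₀ = 0`, levels `|2sg(m+1)| ≤ 10`, `(L:ℤ) + 1 ≤ K₀ ≤ 18`, `a + L ≤ 31`). [this file] -/
theorem room_run_B {ν ν'₀ : ℝ} (hν : 0 < ν) {a L : ℕ} (hsw : ν'₀ ≤ (10011 / 10000 : ℝ) ^ a * ν) (haL : a + L ≤ 31)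
    {sg K₀ : ℤ} (hK : K₀ ≤ 18) (hL : (L : ℤ) + 1 ≤ K₀) (hk : ∀ m, m < L → |2 * sg * ((m : ℤ) + 1)| ≤ 10) :
    ∀ m, m < L → ∀ t : T3, thsum t = 0 → InBox (0, 0, 0) (K₀ - ((m : ℤ) + 1)) t →
      401 / 400 * ν * ‖mv (tadd (column (0, 0, 0) sg ((m : ℤ) + 1)) t)‖ +
        (dR ν (a + (m + 1)) + 1 / 10 ^ 4 * ((10011 / 10000 : ℝ) ^ (m + 1) * ν'₀) + tauR ν (a + (m + 1))) ≤ 12 * ν := by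
  intro m hm t ht hb
  have e : tadd (column (0, 0, 0) sg ((m : ℤ) + 1)) t = tadd (2 * sg * ((m : ℤ) + 1), 2 * sg * ((m : ℤ) + 1), 2 * sg * ((m : ℤ) + 1)) t := by
    have h := column_axis 0 sg ((m : ℤ) + 1) (0, 0, 0) t
    simp only [zero_add, tadd_zero_left] at h
    exact h
  rw [e]
  have hn := norm_mv_axis_box_le' ht hb (hk m hm) (by omega) (by omega : K₀ - ((m : ℤ) + 1) ≤ 18)
  obtain ⟨-, -, hR⟩ := room_budget hν
  have e1 := window_hi hν.le hsw (by omega : a + (m + 1) ≤ 31)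
  obtain ⟨-, e2, -, e3⟩ := tauR_dR_mono hν.le (by omega : a + (m + 1) ≤ 31)
  nlinarith [mul_le_mul_of_nonneg_left hn (by positivity : (0 : ℝ) ≤ 401 / 400 * ν)]

/-- **ROOM, Case B base** (the `hroom` of `…Seed.layer_disc_fcc_ball` at `n = 6`, frame `‖B z‖ ≤ (401/400)ν‖z‖`, bound `dR ν n`, `n ≤ 31`). [this file] -/
theorem room_base_B {ν : ℝ} (hν : 0 < ν) {B : EuclideanSpace ℝ (Fin 3) →ₗ[ℝ] EuclideanSpace ℝ (Fin 3)} (hBup : ∀ z, ‖B z‖ ≤ 401 / 400 * ν * ‖z‖)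
    {n : ℕ} (hn31 : n ≤ 31) : ∀ x, InLayer x → lnorm x ≤ 6 * 6 → ‖B (mv x)‖ + dR ν n ≤ 12 * ν := by
  intro x hx hl
  have hn := norm_mv_axis_box_le' (k := 0) (by simpa [tadd_zero_left] using (show thsum x = 0 from hx.1))
    (by simpa [tadd_zero_left] using inBox_of_lnorm_le hx hl) (by norm_num : |(0 : ℤ)| ≤ 10) (by norm_num) (by norm_num : (3 * 6 : ℤ) ≤ 18)
  rw [tadd_zero_left] at hn
  obtain ⟨-, -, hR⟩ := room_budget hν
  obtain ⟨h0, -, -, e3⟩ := tauR_dR_mono hν.le hn31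
  have h4 : 0 ≤ 1 / 10 ^ 4 * (10347 / 10000 * ν) := by positivity
  nlinarith [hBup (mv x), mul_le_mul_of_nonneg_left hn (by positivity : (0 : ℝ) ≤ 401 / 400 * ν), (tauR_dR_mono hν.le (le_refl 31)).1]

/-! ## §4  The record run -/

/-- ★ **THE RECORD RUN.**  `stack_run_box` at the record constants (`r = 12ν`, `β = (399/400)ν`, `γ = (401/400)ν`, `ν = nn_i`) with the universal
sequences of «Budget» (`τs m = tauR ν (a+m)`, `Ds m = dR ν (a+m)`, `νs m = λ^m ν₀`, `ν's m = Λ^m ν′₀`): every analytic hypothesis is discharged;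
left are the frame bounds, the base patch (window `[ν₀, ν′₀]` with `λ^a ν ≤ ν₀`, `ν′₀ ≤ Λ^a ν`), the Case A column data and `a + L ≤ 31`. [this file] -/
theorem stack_run_box_record {y : Fin N → EuclideanSpace ℝ (Fin 3)} (hy : Function.Injective y) {i : Fin N} (hν : 0 < nearestDist y i)
    {A : Fin N → (EuclideanSpace ℝ (Fin 3) →ₗ[ℝ] EuclideanSpace ℝ (Fin 3))} {Qf : Fin N → (EuclideanSpace ℝ (Fin 3) →ₗᵢ[ℝ] EuclideanSpace ℝ (Fin 3))}
    {P : Fin N → Finset (EuclideanSpace ℝ (Fin 3))} {f : Fin N → EuclideanSpace ℝ (Fin 3) → EuclideanSpace ℝ (Fin 3)}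
    {B : EuclideanSpace ℝ (Fin 3) →ₗ[ℝ] EuclideanSpace ℝ (Fin 3)}
    (hP : ∀ j, dist (y j) (y i) ≤ 12 * nearestDist y i → (P j = fccTwoShellPattern ∨ P j = hcpTwoShellPattern))
    (hA : ∀ j, dist (y j) (y i) ≤ 12 * nearestDist y i → ∀ v ∈ P j, ‖A j v - Qf j v‖ ≤ 1 / 1000)
    (hf : ∀ j, dist (y j) (y i) ≤ 12 * nearestDist y i → ∀ v ∈ P j,
      f j v ∈ Set.range y ∧ dist (f j v) (y j + nearestDist y j • A j v) ≤ 1 / 10 ^ 4 * nearestDist y j)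
    (hinj : ∀ j, dist (y j) (y i) ≤ 12 * nearestDist y i → Set.InjOn (f j) ↑(P j))
    (hex : ∀ j, dist (y j) (y i) ≤ 12 * nearestDist y i → ∀ m, m ≠ j → dist (y m) (y j) ≤ (3 / 2 + 1 / 450) * nearestDist y j →
      ∃ v ∈ P j, f j v = y m)
    (hB : ∀ z, 399 / 400 * nearestDist y i * ‖z‖ ≤ ‖B z‖) (hBup : ∀ z, ‖B z‖ ≤ 401 / 400 * nearestDist y i * ‖z‖)
    {sg : ℤ} (hsg : sg = 1 ∨ sg = -1) {C₀ : List T3} (hC₀ : C₀ ∈ [fccL, fccNegL, hcpL, hcpAltL])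
    {k₀ K₀ : ℤ} {w : T3} (hw : InBox (0, 0, 0) 2 w) (hw0 : thsum w = 0) {a L : ℕ} (haL : a + L ≤ 31) (hK : K₀ ≤ 27) (hL : (L : ℤ) + 1 ≤ K₀)
    (hk : ∀ m, m < L → |k₀ + 2 * sg * ((m : ℤ) + 1)| ≤ 12) {ν₀ ν'₀ : ℝ} (h0 : 0 ≤ ν'₀)
    (hlo : (9967 / 10000 : ℝ) ^ a * nearestDist y i ≤ ν₀) (hsw : ν'₀ ≤ (10011 / 10000 : ℝ) ^ a * nearestDist y i)
    (hbase : ∀ x, InLayer x → InBox (0, 0, 0) K₀ x → ∃ k : Fin N, ∃ M : EuclideanSpace ℝ (Fin 3) →ₗᵢ[ℝ] EuclideanSpace ℝ (Fin 3),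
      dist (y k) (y i) ≤ 12 * nearestDist y i ∧ ν₀ ≤ nearestDist y k ∧ nearestDist y k ≤ ν'₀ ∧
      Estab y A P B i k M C₀ (tadd (tadd (k₀, k₀, k₀) w) x) (tauR (nearestDist y i) a) (dR (nearestDist y i) a)) :
    ∃ offs : ℕ → T3, ∃ Cs : ℕ → List T3, offs 0 = (0, 0, 0) ∧ Cs 0 = C₀ ∧
      (∀ m, m < L → ∃ ε : ℤ, (ε = 1 ∨ ε = -1) ∧ (∀ δ ∈ dL, capv sg ε δ ∈ capL (Cs m) sg) ∧
        offs (m + 1) = tadd (offs m) (capv 0 ε (1, 1, -2))) ∧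
      ∀ m, m ≤ L → Cs m ∈ [fccL, fccNegL, hcpL, hcpAltL] ∧ thsum (offs m) = 0 ∧
        ∀ x, InLayer x → InBox (offs m) (K₀ - (m : ℤ)) x →
          ∃ k : Fin N, ∃ M : EuclideanSpace ℝ (Fin 3) →ₗᵢ[ℝ] EuclideanSpace ℝ (Fin 3),
            dist (y k) (y i) ≤ 12 * nearestDist y i ∧ (9967 / 10000 : ℝ) ^ m * ν₀ ≤ nearestDist y k ∧
            nearestDist y k ≤ (10011 / 10000 : ℝ) ^ m * ν'₀ ∧
            Estab y A P B i k M (Cs m) (tadd (tadd (column (tadd (k₀, k₀, k₀) w) sg (m : ℤ)) (offs m)) x)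
              (tauR (nearestDist y i) (a + m)) (dR (nearestDist y i) (a + m)) := by
  obtain ⟨hτ, hD, hνs, hν's, hmono⟩ := run_structural (ν₀ := ν₀) hν.le h0 hsw haL
  obtain ⟨hΔ, hsmall, hΔk, hid⟩ := run_resolution hν hlo hsw haL
  have hroom := room_run_A hν hsw haL (sg := sg) hw hw0 hK hL hk
  exact stack_run_box hy hP hA hf hinj hex hB hBup hsg hC₀ (τs := fun m => tauR (nearestDist y i) (a + m))
    (Ds := fun m => dR (nearestDist y i) (a + m)) (νs := fun m => (9967 / 10000 : ℝ) ^ m * ν₀)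
    (ν's := fun m => (10011 / 10000 : ℝ) ^ m * ν'₀) hL (by simpa using hbase) hτ hD hνs hν's hΔ hsmall hΔk hid hmono hroom

end Summit.AtomisticToContinuum.Crystallization.Theorems.OverbindingBudgetAffineCompressedCutBoxBounds
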